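import Literature.MathematicalPhysics.QuantumLattice.FermionRectTilingProductState
import Literature.MathematicalPhysics.QuantumLattice.OneBandHoppingFamilyMeanEnergyMinimisers
import Literature.MathematicalPhysics.QuantumLattice.LatticeVectorHoppingInteraction
import Literature.MathematicalPhysics.QuantumLattice.PeriodicLayeredLatticeBilayerCell
import HarnessLib

/-!
# The infinite-volume CLUSTER VARIATIONAL PRINCIPLE for finite-range lattice-fermion models: the cell energy and filling of the
# rectangular cluster product state, and `e_{ρ̄}(Ψ) ≤ (Re tr(H^{open}_{[0,q+1)} ρ₀) − Re Ψ∅)/|C|` whenever the straddling terms vanish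
# — discharged for every one-band hopping model (`t–t′`, `t–t′–t″`, any `Σ_v t_v Φ_v + U·D`)

Topic `Literature/MathematicalPhysics/QuantumLattice` (family `hubbard`; general `d`, §3 on `ℤ²`). Companion of
`FermionRectTilingProductState.lean` (the `L_q`-periodic product `⊗_v ρ₀` of one even box state over the rectangular tiling) and of
`PeriodicInteractionsCellEnergy` / `PeriodicStatesCellAverage` (site energies, the free-boundary bookkeeping identity `sum_siteEnergy_sub_eq`,
`tiGroundEnergyDensityAt Ψ R ρ̄ ≤ ē_q(ω)` for periodic `ω`). Written for stage S2 of the Hubbard material-oracle programme (cell hubbard-fast,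
seat hubbard-box-p3 g15): the object-M (`t–t′–t″`) energy of the S1/S2 seam, `tiGroundEnergyDensityAt (hubbardTT'T''FermionInteraction 1 t′ t″ U) 2 n`,
has certified FLOORS (superadditivity, `HubbardTTPrimeTPPDoublingUAnchors`) but its only CAPS were the `t–t′` caps plus the KINEMATIC allowance
`(16/π²)|t″|` (`holdsOn_tiGroundEnergyDensityAt_objectM_kinematic`), because the torus-limit cluster variational principle of the tree
(`energyDensityTT'_le_re_expect_openBox`, Ruelle 1969 §3.3) is worded for `energyDensityTT'` only. Here the principle is proved DIRECTLY IN INFINITE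
VOLUME, for the variational density `tiGroundEnergyDensityAt` of ANY translation-covariant finite-range interaction:

* §1 GENERIC: for the rectangular tiling state `ω = ⊗_v ρ₀` (`rectTilingState q ρ₀ …`) and a translation-covariant `Ψ` of finite range `R` whose
  STRADDLING TERMS VANISH — `ω(Ψ Y) = 0` for every `Y` meeting the reference cell `[0,q+1)` without lying in it — the sum of the site energies over
  the cell is `tr(H_{[0,q+1)} ρ₀) − ω(Ψ∅)` EXACTLY (`sum_cell_siteEnergy_rectTilingState_eq`, no collar term), the cell-averaged filling is
  `Re tr(N_{[0,q+1)} ρ₀)/|C|` (`cellAvg_density_rectTilingState_eq`), hence **`tiGroundEnergyDensityAt_le_of_rectTilingState`**: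
  `e_{ρ̄}(Ψ, R) ≤ (Re tr(H_{[0,q+1)} ρ₀) − Re ω(Ψ∅))/|C|`, `ρ̄ = Re tr(N ρ₀)/|C|`.
* §2 DISCHARGE of the straddling hypothesis: a hopping term `Φ_v{x, x+v}` joining two different blocks is a sum of products (ODD element of one
  block) × (element of another), so its expectation in the product of EVEN block states is zero (`rectTilingState_expect_vectorHopping_eq_zero_of_straddle`);
  singleton-supported interactions never straddle (`expect_eq_zero_of_straddle_of_subsingleton_support`); sums. Hence the hypothesis holds for the
  nearest-neighbour Hubbard interaction of `ℤ^d`, the `t–t′` and the `t–t′–t″` interactions of `ℤ²` (`…_hubbard`, `…_hubbardTTPrime`, `…_hubbardTT'T''`).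
* §3 THE CAPS: **`tiGroundEnergyDensityAt_hubbardTT'T''_le_of_rectTilingState`** — for every even density matrix `ρ₀` on the open `(q₀+1) × (q₁+1)`
  box, `e^M_{ρ̄}(t,t′,t″,U) ≤ Re tr(H^{open,M}_{box} ρ₀)/|C|` with `H^{open,M}` the free-boundary `t–t′–t″–U` box Hamiltonian (ALL intra-box bonds incl.
  the third-neighbour ones) — the t″-EXACT open-cluster cap of object M; and the `t–t′` / nearest-neighbour twins (for `energyDensityTT'` via
  `tiGroundEnergyDensityAt_hubbardTT'V_zero`-type bridges these reproduce the torus-route caps, now for every `tiGroundEnergyDensityAt` consumer).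

Everything is PROVED; no definition, no named fact, no number, no `sorry`. HONEST SCOPE: upper bounds only; the evaluation of `tr(H ρ₀)` for an
explicit cluster vector (the kernel certificates of `HubbardOpenBoxEDUpperCertificate*`, hubbard-box-p2) and the identification of the open-box
Hamiltonian on `Fock (Orb (Fin a ×ₗ Fin b))` with `Ψ.localHamiltonian (halfOpenRect q)` are the business of a companion bridge file; nothing here
bears on order / pairing.

## Tree / Mathlib search

REUSED: `rectTilingState(_expect_box_zero/_isPeriodic/_expect_mul_eq_zero_of_odd)`, `rectPartition(_block_zero)`, `halfOpenRect`, `cellPos_mem_halfOpenRect`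
(`FermionRectTilingProductState`); `siteEnergy`, `sum_siteEnergy_sub_eq`, `siteEnergy_eq_expect_shift_meanEnergyObs` (`PeriodicInteractionsCellEnergy`);
`IsPeriodic.tiGroundEnergyDensityAt_le_cellAvg`, `density_shift_eq` (`PeriodicStatesCellAverage`, `PeriodicLayeredLatticeBilayerCell`); `meanEnergy`, `compatible`,
`fermionEmbed_incl_cAt`, `fermionEmbed_conjTranspose`, `parityAut_creation`, `cAt`, `nAt`, `totalNumber`; `vectorHoppingFermionInteraction`,
`hubbardFermionInteraction_apply_eq_onSite_add_sum_vectorHopping`, `diagHoppingFermionInteraction_apply_eq_sum_vectorHopping`,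
`axialRange2HoppingFermionInteraction_apply_eq_sum_vectorHopping`, `hubbardTTPrimeFermionInteraction_apply`, `hubbardTT'T''FermionInteraction_apply`.
`rg 'tiGroundEnergyDensityAt_le' --decl` (QuantumLattice): only `tiGroundEnergyDensityAt_le_meanEnergy` (generic) — no cluster cap for the variational
density existed.

## References

* D. Ruelle, *Statistical Mechanics: Rigorous Results* (1969), §3.3 (cluster / product trial states for the energy density). [cite: Ruelle1969, §3.3]
* O. Bratteli, D. W. Robinson, *OAQSM 2* (1997), §6.2.4, Thm. 6.2.40 (periodic product states, mean energy). [cite: BratteliRobinsonII1997, Thm. 6.2.40]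
* H. Araki, H. Moriya, Rev. Math. Phys. 15 (2003) 93, §4.1 eq. (4.8), §11.1 Thm. 11.2 (even product states vanish on odd elements). [cite: ArakiMoriya2003, §11.1 Theorem 11.2]
* E. Pavarini et al., PRL 87 (2001) 047003, eq. (1) (the `t–t′–t″` one-band model). [cite: PavariniEtAl2001, eq. (1)]
-/

noncomputable section

namespace Literature.MathematicalPhysics.QuantumLattice

open Matrix Finset HubbardWave0 Literature.Probability.LatticeModels ThermodynamicLimit
open scoped ComplexOrder BigOperators

namespace InfVolFermionState

variable {d : ℕ}

/-! ### §0. Summing over the cell -/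

/-- The cell points `pos c`, `c ∈ Cell q`, enumerate the rectangle `[0,q+1)` bijectively: `Σ_{c} f(pos c) = Σ_{x ∈ [0,q+1)} f x`.
[cite: ArakiMoriya2003, §4.1 Def. 4.3] -/
theorem sum_cell_eq_sum_halfOpenRect {α : Type*} [AddCommMonoid α] (q : Fin d → ℕ) (f : Site d → α) :
    ∑ c : Cell q, f (cellPos c) = ∑ x ∈ halfOpenRect q, f x := by
  refine Finset.sum_bij (fun c _ => cellPos c) (fun c _ => cellPos_mem_halfOpenRect c) (fun c₁ _ c₂ _ h => ?_) (fun x hx => ?_)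
    (fun _ _ => rfl)
  · funext i
    have hi := congrFun h i
    simp only [cellPos, Nat.cast_inj] at hi
    exact Fin.ext hi
  · rw [mem_halfOpenRect] at hx
    refine ⟨fun i => ⟨(x i).toNat, ?_⟩, Finset.mem_univ _, ?_⟩
    · have h1 := (hx i).1; have h2 := (hx i).2; omega
    · funext i
      have h1 := (hx i).1
      simp only [cellPos, Int.toNat_of_nonneg h1]

/-! ### §1. The generic cluster variational principle -/

section Generic

variable (q : Fin d → ℕ) (ρ₀ : FermionOp (halfOpenRect q)) (hev : parityAut ρ₀ = ρ₀) (hpsd : ρ₀.PosSemidef) (htr : ρ₀.trace = 1)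

/-- **The cell sum of the site energies of the tiling state is the free-boundary cell energy** when the straddling terms vanish:
`Σ_{c ∈ C} ε(pos c) = tr(H_{[0,q+1)} ρ₀) − ω(Ψ∅)` (no collar term). [cite: BratteliRobinsonII1997, §6.2.4 (Prop. 6.2.39 ff.)] -/
theorem sum_cell_siteEnergy_rectTilingState_eq {Ψ : FermionInteraction d} {R : ℝ} (hR : Ψ.HasFiniteRange R)
    (hvan : ∀ Y : Finset (Site d), ¬ Y ⊆ halfOpenRect q → (Y ∩ halfOpenRect q).Nonempty →
      (rectTilingState q ρ₀ hev hpsd htr).expect Y (Ψ.Φ Y) = 0) :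
    ∑ c : Cell q, siteEnergy Ψ (rectTilingState q ρ₀ hev hpsd htr) R (cellPos c) =
      (Ψ.localHamiltonian (halfOpenRect q) * ρ₀).trace - (rectTilingState q ρ₀ hev hpsd htr).expect ∅ (Ψ.Φ ∅) := by
  rw [sum_cell_eq_sum_halfOpenRect q (fun x => siteEnergy Ψ (rectTilingState q ρ₀ hev hpsd htr) R x),
    ← rectTilingState_expect_box_zero q ρ₀ hev hpsd htr]
  have h := InfVolFermionState.sum_siteEnergy_sub_eq (Ψ := Ψ) (ω := rectTilingState q ρ₀ hev hpsd htr) hR (halfOpenRect q)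
  have h0 : ∑ Y ∈ (thicken (halfOpenRect q) R).powerset with ¬ Y ⊆ halfOpenRect q,
      ((Y ∩ halfOpenRect q).card : ℂ) * ((Y.card : ℂ)⁻¹ * (rectTilingState q ρ₀ hev hpsd htr).expect Y (Ψ.Φ Y)) = 0 := by
    refine Finset.sum_eq_zero fun Y hY => ?_
    rw [Finset.mem_filter] at hY
    by_cases hne : (Y ∩ halfOpenRect q).Nonempty
    · rw [hvan Y hY.2 hne, mul_zero, mul_zero]
    · rw [Finset.not_nonempty_iff_eq_empty.1 hne, Finset.card_empty, Nat.cast_zero, zero_mul]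
  rw [h0, sub_eq_zero] at h
  exact h

/-- **The cell-averaged energy density of the tiling state** (straddling terms vanishing, `Ψ` translation covariant):
`|C|⁻¹ Σ_c e_Ψ(ω ∘ τ_{pos c}) = (Re tr(H_{[0,q+1)} ρ₀) − Re ω(Ψ∅))/|C|`. [cite: BratteliRobinsonII1997, §6.2.4 (mean energy)] -/
theorem cellAvg_meanEnergy_rectTilingState_eq {Ψ : FermionInteraction d} {R : ℝ} (hT : Ψ.IsTranslationInvariant) (hR : Ψ.HasFiniteRange R)
    (hvan : ∀ Y : Finset (Site d), ¬ Y ⊆ halfOpenRect q → (Y ∩ halfOpenRect q).Nonempty →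
      (rectTilingState q ρ₀ hev hpsd htr).expect Y (Ψ.Φ Y) = 0) :
    (Fintype.card (Cell q) : ℝ)⁻¹ * ∑ c : Cell q, ((rectTilingState q ρ₀ hev hpsd htr).shift (cellPos c)).meanEnergy Ψ R =
      (Fintype.card (Cell q) : ℝ)⁻¹ *
        ((Ψ.localHamiltonian (halfOpenRect q) * ρ₀).trace - (rectTilingState q ρ₀ hev hpsd htr).expect ∅ (Ψ.Φ ∅)).re := by
  congr 1
  have hterm : ∀ c : Cell q, ((rectTilingState q ρ₀ hev hpsd htr).shift (cellPos c)).meanEnergy Ψ R =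
      (siteEnergy Ψ (rectTilingState q ρ₀ hev hpsd htr) R (cellPos c)).re := fun c => by
    rw [meanEnergy, siteEnergy_eq_expect_shift_meanEnergyObs hT]
  simp_rw [hterm]
  rw [← Complex.re_sum, sum_cell_siteEnergy_rectTilingState_eq q ρ₀ hev hpsd htr hR hvan]

/-- The total number operator of a region as a sum over its sites: `N_Λ = Σ_{x ∈ Λ} (n_{x↑} + n_{x↓})`. [cite: Lieb1995] -/
theorem totalNumber_eq_sum_attach_nAt (Λ : Finset (Site d)) :
    (totalNumber : FermionOp Λ) = ∑ x ∈ Λ.attach, (nAt x.1 x.2 0 + nAt x.1 x.2 1) := by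
  let e : PolySite Λ ≃ {x // x ∈ Λ} :=
    ⟨fun a => ⟨ofLex a.1, PolySite.ofLex_mem a⟩, fun x => PolySite.pt x.1 x.2, fun a => PolySite.pt_ofLex a,
      fun x => Subtype.ext rfl⟩
  rw [totalNumber, ← Finset.univ_eq_attach]
  refine Fintype.sum_equiv e _ _ fun a => ?_
  rw [Fin.sum_univ_two, nAt, nAt, show PolySite.pt (e a).1 (e a).2 = e.symm (e a) from rfl, Equiv.symm_apply_apply]

/-- **The translated densities of the tiling state over the cell sum to the particle number of `ρ₀`**:
`Σ_c ρ(ω ∘ τ_{pos c}) = Re tr(N_{[0,q+1)} ρ₀)`. [cite: ArakiMoriya2003, §4.1 (number operators)] -/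
theorem sum_cell_density_rectTilingState_eq :
    ∑ c : Cell q, ((rectTilingState q ρ₀ hev hpsd htr).shift (cellPos c)).density =
      ((totalNumber : FermionOp (halfOpenRect q)) * ρ₀).trace.re := by
  set ω := rectTilingState q ρ₀ hev hpsd htr with hω
  -- each translated density reads the number operator at `pos c`, a site of the reference cell
  have hterm : ∀ x : Site d, ∀ hx : x ∈ halfOpenRect q, (ω.shift x).density =
      (ω.expect (halfOpenRect q) (nAt x hx 0 + nAt x hx 1)).re := by
    intro x hx
    rw [density_shift_eq]
    congr 1
    have hsub : ({0 + x} : Finset (Site d)) ⊆ halfOpenRect q := Finset.singleton_subset_iff.2 (by rw [zero_add]; exact hx)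
    rw [← ω.compatible hsub, map_add, map_add, map_add]
    have h1 : ∀ σ, fermionEmbed (PolySite.incl hsub) (nAt (0 + x) (mem_singleton_self _) σ) = nAt x hx σ := fun σ => by
      rw [nAt, fermionEmbed_numberOp, PolySite.incl_pt, nAt]
      exact congrArg (fun y => numberOp y σ) (Subtype.ext (by simp))
    rw [h1, h1]
  rw [sum_cell_eq_sum_halfOpenRect q (fun x => (ω.shift x).density), ← Finset.sum_attach (halfOpenRect q),
    Finset.sum_congr rfl fun x _ => hterm x.1 x.2, ← Complex.re_sum, ← map_sum, ← totalNumber_eq_sum_attach_nAt,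
    hω, rectTilingState_expect_box_zero]

/-- **THE INFINITE-VOLUME CLUSTER VARIATIONAL PRINCIPLE (generic form).** For the rectangular tiling state `ω = ⊗_v ρ₀` of an even density
matrix `ρ₀` on the cell `[0,q+1)` and a translation-covariant interaction `Ψ` of finite range `R` whose terms straddling the cell boundary have zero
expectation in `ω`: the translation-invariant variational density at the cluster's filling `ρ̄ = Re tr(N ρ₀)/|C|` is at most the cluster's energy
per site, `e_{ρ̄}(Ψ, R) ≤ (Re tr(H_{[0,q+1)} ρ₀) − Re ω(Ψ∅))/|C|`. [cite: Ruelle1969, §3.3] [cite: BratteliRobinsonII1997, Thm. 6.2.40] -/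
theorem tiGroundEnergyDensityAt_le_of_rectTilingState {Ψ : FermionInteraction d} {R : ℝ} (hT : Ψ.IsTranslationInvariant)
    (hR : Ψ.HasFiniteRange R)
    (hvan : ∀ Y : Finset (Site d), ¬ Y ⊆ halfOpenRect q → (Y ∩ halfOpenRect q).Nonempty →
      (rectTilingState q ρ₀ hev hpsd htr).expect Y (Ψ.Φ Y) = 0) :
    Ψ.tiGroundEnergyDensityAt R ((Fintype.card (Cell q) : ℝ)⁻¹ * ((totalNumber : FermionOp (halfOpenRect q)) * ρ₀).trace.re) ≤
      (Fintype.card (Cell q) : ℝ)⁻¹ *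
        ((Ψ.localHamiltonian (halfOpenRect q) * ρ₀).trace - (rectTilingState q ρ₀ hev hpsd htr).expect ∅ (Ψ.Φ ∅)).re := by
  rw [← sum_cell_density_rectTilingState_eq q ρ₀ hev hpsd htr, ← cellAvg_meanEnergy_rectTilingState_eq q ρ₀ hev hpsd htr hT hR hvan]
  exact (rectTilingState_isPeriodic q ρ₀ hev hpsd htr).tiGroundEnergyDensityAt_le_cellAvg Ψ R

end Generic

/-! ### §2. The straddling terms of one-band hopping models vanish in the product state -/

section Straddle

variable (q : Fin d → ℕ) (ρ₀ : FermionOp (halfOpenRect q)) (hev : parityAut ρ₀ = ρ₀) (hpsd : ρ₀.PosSemidef) (htr : ρ₀.trace = 1)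

/-- A site lies in the reference cell iff its class in the rectangular partition is `0`. [cite: ArakiMoriya2003, §4.1 Def. 4.3] -/
theorem mem_halfOpenRect_iff_cls_eq_zero (x : Site d) : x ∈ halfOpenRect q ↔ (rectPartition d q).cls x = 0 := by
  rw [← rectPartition_block_zero]
  exact (rectPartition d q).mem_block_iff 0 x

/-- **A pair straddling the cell boundary joins two different blocks**: if `{x, y}` meets `[0,q+1)` without lying in it, then
`cls x ≠ cls y`. [cite: ArakiMoriya2003, §4.1 Def. 4.3] -/
theorem cls_ne_cls_of_pair_straddle {x y : Site d} (hY : ¬ ({x, y} : Finset (Site d)) ⊆ halfOpenRect q)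
    (hY' : (({x, y} : Finset (Site d)) ∩ halfOpenRect q).Nonempty) :
    (rectPartition d q).cls x ≠ (rectPartition d q).cls y := by
  intro h
  by_cases hx : x ∈ halfOpenRect q
  · have hy : y ∈ halfOpenRect q := by
      rw [mem_halfOpenRect_iff_cls_eq_zero] at hx ⊢; rw [← h, hx]
    exact hY (Finset.insert_subset hx (Finset.singleton_subset_iff.2 hy))
  · have hy : y ∉ halfOpenRect q := by
      rw [mem_halfOpenRect_iff_cls_eq_zero] at hx ⊢; rwa [← h]
    obtain ⟨z, hz⟩ := hY'
    rw [Finset.mem_inter, Finset.mem_insert, Finset.mem_singleton] at hz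
    rcases hz.1 with rfl | rfl
    · exact hx hz.2
    · exact hy hz.2

/-- **A hopping word `c†_{xσ} c_{yτ}` between two different blocks has zero expectation in the tiling state** (on any region `Y`
consisting of the two sites): `c†_{xσ}` is an ODD element of the block of `x`, `c_{yτ}` an element of the block of `y`, and the product of
even block states kills odd factors. [cite: ArakiMoriya2003, §4.1 eq. (4.8) and §11.1 Theorem 11.2] -/
theorem rectTilingState_expect_creation_mul_annihilation_eq_zero {x y : Site d}
    (hxy : (rectPartition d q).cls x ≠ (rectPartition d q).cls y) {Y : Finset (Site d)} (hx : x ∈ Y) (hy : y ∈ Y)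
    (hYxy : ∀ z ∈ Y, z = x ∨ z = y) (σ τ : Fin 2) :
    (rectTilingState q ρ₀ hev hpsd htr).expect Y ((cAt x hx σ)ᴴ * cAt y hy τ) = 0 := by
  set P := rectPartition d q with hP
  have hx' : x ∈ P.blockLoc Y (P.cls x) := P.mem_blockLoc.2 ⟨hx, rfl⟩
  have hy' : y ∈ P.blockLoc Y (P.cls y) := P.mem_blockLoc.2 ⟨hy, rfl⟩
  have ha : (cAt x hx σ : FermionOp Y)ᴴ = fermionEmbed (P.blockEmb Y (P.cls x)) ((cAt x hx' σ)ᴴ) := by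
    rw [fermionEmbed_conjTranspose, BlockPartition.blockEmb, fermionEmbed_incl_cAt]
  have hb : (cAt y hy τ : FermionOp Y) = fermionEmbed (P.blockEmb Y (P.cls y)) (cAt y hy' τ) := by
    rw [BlockPartition.blockEmb, fermionEmbed_incl_cAt]
  have hΛ : ∀ k ∈ P.blockClasses Y, k = P.cls x ∨ k = P.cls y := by
    intro k hk
    obtain ⟨z, hz, rfl⟩ := Finset.mem_image.1 hk
    rcases hYxy z hz with rfl | rfl
    · exact Or.inl rfl
    · exact Or.inr rfl
  have hodd : parityAut ((cAt x hx' σ : FermionOp (P.blockLoc Y (P.cls x)))ᴴ) = -(cAt x hx' σ)ᴴ := by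
    simp only [cAt, annihilation_conjTranspose, parityAut_creation]
  rw [ha, hb]
  exact rectTilingState_expect_mul_eq_zero_of_odd q ρ₀ hev hpsd htr Y hxy hΛ hodd _

/-- **The straddling terms of the hopping interaction along `v` vanish** in the tiling state.
[cite: ArakiMoriya2003, §11.1 Theorem 11.2] [cite: PavariniEtAl2001, eq. (1)] -/
theorem rectTilingState_expect_vectorHopping_eq_zero_of_straddle (v : Site d) (t : ℝ) {Y : Finset (Site d)}
    (hY : ¬ Y ⊆ halfOpenRect q) (hY' : (Y ∩ halfOpenRect q).Nonempty) :
    (rectTilingState q ρ₀ hev hpsd htr).expect Y ((vectorHoppingFermionInteraction d v t).Φ Y) = 0 := by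
  by_cases h : ∃ x : Site d, Y = {x, x + v}
  · obtain ⟨x, rfl⟩ := h
    by_cases hv : v = 0
    · -- degenerate vector: the «pair» is the singleton `{x}`, which cannot straddle
      subst hv
      obtain ⟨z, hz⟩ := hY'
      rw [add_zero, Finset.pair_eq_singleton, Finset.mem_inter, Finset.mem_singleton] at hz
      rw [add_zero, Finset.pair_eq_singleton] at hY
      exact absurd (Finset.singleton_subset_iff.2 (hz.1 ▸ hz.2)) hY
    have hcls := cls_ne_cls_of_pair_straddle q hY hY'
    have hmem : ∀ z ∈ ({x, x + v} : Finset (Site d)), z = x ∨ z = x + v := fun z hz => by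
      simpa only [Finset.mem_insert, Finset.mem_singleton] using hz
    rw [vectorHoppingFermionInteraction_apply_pair hv, map_smul, map_sum]
    refine smul_eq_zero_of_right _ (Finset.sum_eq_zero fun σ _ => ?_)
    rw [map_add, rectTilingState_expect_creation_mul_annihilation_eq_zero q ρ₀ hev hpsd htr hcls _ _ hmem,
      rectTilingState_expect_creation_mul_annihilation_eq_zero q ρ₀ hev hpsd htr hcls.symm _ _
        (fun z hz => (hmem z hz).symm), add_zero]
  · push Not at h
    rw [vectorHoppingFermionInteraction_apply_eq_zero t (fun x => h x), map_zero]

/-- **The straddling terms of the nearest-neighbour Hubbard interaction of `ℤ^d` vanish** in the tiling state (the on-site terms never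
straddle; the bond terms are hopping words between two blocks). [cite: ArakiMoriya2003, §11.1 Theorem 11.2] [cite: arXiv9311033, §2] -/
theorem rectTilingState_expect_hubbard_eq_zero_of_straddle (t U : ℝ) {Y : Finset (Site d)}
    (hY : ¬ Y ⊆ halfOpenRect q) (hY' : (Y ∩ halfOpenRect q).Nonempty) :
    (rectTilingState q ρ₀ hev hpsd htr).expect Y ((hubbardFermionInteraction d t U).Φ Y) = 0 := by
  by_cases h1 : ∃ x : Site d, Y = {x}
  · obtain ⟨x, rfl⟩ := h1
    obtain ⟨z, hz⟩ := hY'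
    rw [Finset.mem_inter, Finset.mem_singleton] at hz
    exact absurd (Finset.singleton_subset_iff.2 (hz.1 ▸ hz.2)) hY
  by_cases h2 : ∃ (x : Site d) (i : Fin d), Y = {x, x + unitVec i}
  · obtain ⟨x, i, rfl⟩ := h2
    have hcls := cls_ne_cls_of_pair_straddle q hY hY'
    have hmem : ∀ z ∈ ({x, x + unitVec i} : Finset (Site d)), z = x ∨ z = x + unitVec i := fun z hz => by
      simpa only [Finset.mem_insert, Finset.mem_singleton] using hz
    rw [hubbardFermionInteraction_apply_pair, map_smul, map_sum]
    refine smul_eq_zero_of_right _ (Finset.sum_eq_zero fun σ _ => ?_)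
    rw [map_add, rectTilingState_expect_creation_mul_annihilation_eq_zero q ρ₀ hev hpsd htr hcls _ _ hmem,
      rectTilingState_expect_creation_mul_annihilation_eq_zero q ρ₀ hev hpsd htr hcls.symm _ _
        (fun z hz => (hmem z hz).symm), add_zero]
  · push Not at h1 h2
    rw [hubbardFermionInteraction_apply_eq_zero t U (fun x => h1 x) (fun x i => h2 x i), map_zero]

/-- **The straddling terms of the `t–t'` interaction of `ℤ²` vanish** in the tiling state. [cite: ArakiMoriya2003, §11.1 Theorem 11.2] [cite: XuEtAl2024, eq. (1)] -/
theorem rectTilingState_expect_hubbardTTPrime_eq_zero_of_straddle (q : Fin 2 → ℕ) (ρ₀ : FermionOp (halfOpenRect q))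
    (hev : parityAut ρ₀ = ρ₀) (hpsd : ρ₀.PosSemidef) (htr : ρ₀.trace = 1) (t t' U : ℝ) {Y : Finset (Site 2)}
    (hY : ¬ Y ⊆ halfOpenRect q) (hY' : (Y ∩ halfOpenRect q).Nonempty) :
    (rectTilingState q ρ₀ hev hpsd htr).expect Y ((hubbardTTPrimeFermionInteraction t t' U).Φ Y) = 0 := by
  rw [hubbardTTPrimeFermionInteraction_apply, diagHoppingFermionInteraction_apply_eq_sum_vectorHopping, map_add, map_sum,
    rectTilingState_expect_hubbard_eq_zero_of_straddle q ρ₀ hev hpsd htr t U hY hY', zero_add]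
  exact Finset.sum_eq_zero fun s _ => rectTilingState_expect_vectorHopping_eq_zero_of_straddle q ρ₀ hev hpsd htr _ _ hY hY'

/-- **The straddling terms of the `t–t'–t''` interaction of `ℤ²` vanish** in the tiling state. [cite: ArakiMoriya2003, §11.1 Theorem 11.2] [cite: PavariniEtAl2001, eq. (1)] -/
theorem rectTilingState_expect_hubbardTT'T''_eq_zero_of_straddle (q : Fin 2 → ℕ) (ρ₀ : FermionOp (halfOpenRect q))
    (hev : parityAut ρ₀ = ρ₀) (hpsd : ρ₀.PosSemidef) (htr : ρ₀.trace = 1) (t t' t'' U : ℝ) {Y : Finset (Site 2)}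
    (hY : ¬ Y ⊆ halfOpenRect q) (hY' : (Y ∩ halfOpenRect q).Nonempty) :
    (rectTilingState q ρ₀ hev hpsd htr).expect Y ((hubbardTT'T''FermionInteraction t t' t'' U).Φ Y) = 0 := by
  rw [hubbardTT'T''FermionInteraction_apply, axialRange2HoppingFermionInteraction_apply_eq_sum_vectorHopping, map_add, map_sum,
    rectTilingState_expect_hubbardTTPrime_eq_zero_of_straddle q ρ₀ hev hpsd htr t t' U hY hY', zero_add]
  exact Finset.sum_eq_zero fun i _ => rectTilingState_expect_vectorHopping_eq_zero_of_straddle q ρ₀ hev hpsd htr _ _ hY hY'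

end Straddle

/-! ### §3. The cluster caps of the one-band models -/

section Caps

/-- The `t–t'–t''` interaction has no vacuum term: `Φ ∅ = 0`. [cite: PavariniEtAl2001, eq. (1)] -/
theorem hubbardTT'T''FermionInteraction_apply_empty (t t' t'' U : ℝ) : (hubbardTT'T''FermionInteraction t t' t'' U).Φ ∅ = 0 := by
  rw [hubbardTT'T''FermionInteraction_apply, hubbardTTPrimeFermionInteraction_apply, hubbardFermionInteraction_apply_empty,
    diagHoppingFermionInteraction_apply_eq_sum_vectorHopping, axialRange2HoppingFermionInteraction_apply_eq_sum_vectorHopping, zero_add]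
  have h0 : ∀ v : Site 2, ∀ s : ℝ, (vectorHoppingFermionInteraction 2 v s).Φ ∅ = 0 := fun v s =>
    vectorHoppingFermionInteraction_apply_eq_zero s fun x h => Finset.insert_ne_empty _ _ h.symm
  simp only [h0, Finset.sum_const_zero, add_zero]

/-- The `t–t'` interaction has no vacuum term: `Φ ∅ = 0`. [cite: XuEtAl2024, eq. (1)] -/
theorem hubbardTTPrimeFermionInteraction_apply_empty (t t' U : ℝ) : (hubbardTTPrimeFermionInteraction t t' U).Φ ∅ = 0 := by
  have h := hubbardTT'T''FermionInteraction_apply_empty t t' 0 U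
  rw [hubbardTT'T''FermionInteraction_apply, axialRange2HoppingFermionInteraction_apply_eq_sum_vectorHopping] at h
  have h0 : ∀ v : Site 2, (vectorHoppingFermionInteraction 2 v 0).Φ ∅ = 0 := fun v =>
    vectorHoppingFermionInteraction_apply_eq_zero 0 fun x h => Finset.insert_ne_empty _ _ h.symm
  simpa only [h0, Finset.sum_const_zero, add_zero] using h

/-- **THE t″-EXACT OPEN-CLUSTER CAP OF OBJECT M.** For every even density matrix `ρ₀` on the open `(q₀+1) × (q₁+1)` box `[0,q+1) ⊆ ℤ²`,
the translation-invariant variational energy density of the `t–t'–t''–U` Hubbard model at the cluster's mean filling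
`ρ̄ = Re tr(N ρ₀)/|C|` and range `R ≥ 2` is at most the cluster's free-boundary energy per site:
`e^M_{ρ̄} ≤ Re tr(H^{M,open}_{[0,q+1)} ρ₀)/|C|` — ALL intra-box bonds (nearest, diagonal, third-neighbour) are read exactly, no kinematic
`|t''|` allowance. [cite: Ruelle1969, §3.3] [cite: PavariniEtAl2001, eq. (1)] -/
theorem tiGroundEnergyDensityAt_hubbardTT'T''_le_of_rectTilingState (q : Fin 2 → ℕ) (ρ₀ : FermionOp (halfOpenRect q))
    (hev : parityAut ρ₀ = ρ₀) (hpsd : ρ₀.PosSemidef) (htr : ρ₀.trace = 1) (t t' t'' U : ℝ) {R : ℝ} (hR : 2 ≤ R) :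
    (hubbardTT'T''FermionInteraction t t' t'' U).tiGroundEnergyDensityAt R
        ((Fintype.card (Cell q) : ℝ)⁻¹ * ((totalNumber : FermionOp (halfOpenRect q)) * ρ₀).trace.re) ≤
      (Fintype.card (Cell q) : ℝ)⁻¹ * ((hubbardTT'T''FermionInteraction t t' t'' U).localHamiltonian (halfOpenRect q) * ρ₀).trace.re := by
  have h := tiGroundEnergyDensityAt_le_of_rectTilingState q ρ₀ hev hpsd htr (hubbardTT'T''FermionInteraction_isTranslationInvariant t t' t'' U)
    ((hubbardTT'T''FermionInteraction_hasFiniteRange t t' t'' U).of_le hR)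
    (fun Y hY hY' => rectTilingState_expect_hubbardTT'T''_eq_zero_of_straddle q ρ₀ hev hpsd htr t t' t'' U hY hY')
  rwa [hubbardTT'T''FermionInteraction_apply_empty, map_zero, sub_zero] at h

/-- **The open-cluster cap of the `t–t'` model for the variational density** (same statement at `t'' = 0`, range `R ≥ 1`).
[cite: Ruelle1969, §3.3] [cite: XuEtAl2024, eq. (1)] -/
theorem tiGroundEnergyDensityAt_hubbardTTPrime_le_of_rectTilingState (q : Fin 2 → ℕ) (ρ₀ : FermionOp (halfOpenRect q))
    (hev : parityAut ρ₀ = ρ₀) (hpsd : ρ₀.PosSemidef) (htr : ρ₀.trace = 1) (t t' U : ℝ) {R : ℝ} (hR : 1 ≤ R) :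
    (hubbardTTPrimeFermionInteraction t t' U).tiGroundEnergyDensityAt R
        ((Fintype.card (Cell q) : ℝ)⁻¹ * ((totalNumber : FermionOp (halfOpenRect q)) * ρ₀).trace.re) ≤
      (Fintype.card (Cell q) : ℝ)⁻¹ * ((hubbardTTPrimeFermionInteraction t t' U).localHamiltonian (halfOpenRect q) * ρ₀).trace.re := by
  have h := tiGroundEnergyDensityAt_le_of_rectTilingState q ρ₀ hev hpsd htr (hubbardTTPrimeFermionInteraction_isTranslationInvariant t t' U)
    ((hubbardTTPrimeFermionInteraction_hasFiniteRange t t' U).of_le hR)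
    (fun Y hY hY' => rectTilingState_expect_hubbardTTPrime_eq_zero_of_straddle q ρ₀ hev hpsd htr t t' U hY hY')
  rwa [hubbardTTPrimeFermionInteraction_apply_empty, map_zero, sub_zero] at h

/-- **The open-cluster cap of the nearest-neighbour Hubbard model of `ℤ^d` for the variational density** (any `d`, any rectangular
cluster, range `R ≥ 1`). [cite: Ruelle1969, §3.3] [cite: arXiv9311033, §2] -/
theorem tiGroundEnergyDensityAt_hubbard_le_of_rectTilingState (q : Fin d → ℕ) (ρ₀ : FermionOp (halfOpenRect q))
    (hev : parityAut ρ₀ = ρ₀) (hpsd : ρ₀.PosSemidef) (htr : ρ₀.trace = 1) (t U : ℝ) {R : ℝ} (hR : 1 ≤ R) :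
    (hubbardFermionInteraction d t U).tiGroundEnergyDensityAt R
        ((Fintype.card (Cell q) : ℝ)⁻¹ * ((totalNumber : FermionOp (halfOpenRect q)) * ρ₀).trace.re) ≤
      (Fintype.card (Cell q) : ℝ)⁻¹ * ((hubbardFermionInteraction d t U).localHamiltonian (halfOpenRect q) * ρ₀).trace.re := by
  have h := tiGroundEnergyDensityAt_le_of_rectTilingState q ρ₀ hev hpsd htr (hubbardFermionInteraction_isTranslationInvariant t U)
    ((hubbardFermionInteraction_hasFiniteRange t U).of_le hR)
    (fun Y hY hY' => rectTilingState_expect_hubbard_eq_zero_of_straddle q ρ₀ hev hpsd htr t U hY hY')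
  rwa [hubbardFermionInteraction_apply_empty, map_zero, sub_zero] at h

end Caps

end InfVolFermionState

end Literature.MathematicalPhysics.QuantumLattice

end
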